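import Literature.NumberTheory.EllipticCurves.HasseWeilGoodReductionFrobeniusProofs
import Literature.NumberTheory.EllipticCurves.GoodReductionUnramifiedProofs
import Literature.NumberTheory.EllipticCurves.PointDivisibilityProofs
import HarnessLib

/-!
# `φ^f - 1` is onto the `p`-primary torsion at a good place `v ∤ p`
# (the nice-point supply for Clark–Sharif 2010, §3.6)

Topic `NumberTheory/EllipticCurves`; theorems only. Part of the inline proof programme of
`Literature.NumberTheory.EllipticCurves.ClarkSharif2010_thm2`: this file discharges the
hypothesis `hnice` of `PeriodIndexDecompositionIndex` / `PeriodIndexGlobalIndex` — for every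
`f ≥ 1` and every `a ∈ E[P]` there is an `I_𝔓`-invariant `z ∈ E(K̄)` with `φ^f z - z = a` — by
taking `z` in the `p`-primary torsion `E[p^∞]` (`P = pⁿ`), which is unramified at `v`
(Silverman VII.4.1, `WeierstrassCurve.smul_eq_of_mem_inertia_of_nsmul_eq_zero`). This replaces
Lang's theorem `H¹(K_w^{nr}/F, E) = 0` over the unramified extensions `F/K_w`.

**Surjectivity of `φ^f - 1` on `E[p^∞]`** (`exists_mem_geomPrimaryTorsion_frobenius_pow_sub_eq`).
The kernel of `φ^f - 1` on `E[p^∞]` is finite: the reduction map on `p`-primary torsion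
(`WeierstrassCurve.exists_reduceTorsionHom`, Silverman VII.3.1(b)/VII.2.1, equivariant for the
arithmetic Frobenius) injects it into the points of `Ẽ_v` fixed by the `q^f`-power map, whose
coordinates are roots of `X^{q^f} - X` (`finite_setOf_frobenius_pow_smul_eq`). An endomorphism
`M` of a `p`-divisible `p`-primary torsion group with finite layers and finite kernel of order
`≤ p^s` is onto: on `B = E[p^{k+s}]` the image has index `#ker(M|_B) ∣ p^s`, so contains
`p^s B ⊇ E[p^k]` (`exists_eq_of_finite_ker`, Lagrange `AddSubgroup.nsmul_index_mem`). (This is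
the counting shadow of "`1 - φ^f` is a separable isogeny of `Ẽ_v ⊗ 𝔽_{q^f}`", Lang 1956.)

## References

* P. L. Clark, S. Sharif, *Period, index and potential Ш*, ANT 4 (2010), §3.6
  (`ClarkSharif2010`).
* J. H. Silverman, *The Arithmetic of Elliptic Curves*, 2nd ed. (2009), VII.3.1, VII.4.1
  (`SilvermanAEC2009`).
* S. Lang, *Algebraic groups over finite fields*, Amer. J. Math. 78 (1956) (`Lang1956`, NOT
  read; only the counting shadow above is used).
-/

noncomputable section

open scoped Classical Pointwise
open NumberField IsDedekindDomain Field Polynomial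
open Literature.NumberTheory.GaloisRepresentations IsDedekindDomain.HeightOneSpectrum

universe u

namespace Literature.NumberTheory.EllipticCurves

/-! ### Points of a curve over a finite field fixed by a power of Frobenius -/

/-- For a finite field `k` with `q` elements, `σ_q ∈ Γ_k` with `σ_q x = x^q`, and `f ≥ 1`, only
finitely many geometric points of a Weierstrass curve over `k` are fixed by `σ_q^f` (their
coordinates are roots of `X^{q^f} - X`). [folklore] -/
theorem finite_setOf_frobenius_pow_smul_eq {k : Type u} [Field k] [Finite k]
    (W : WeierstrassCurve k) {σ : absoluteGaloisGroup k}
    (hσ : ∀ x : AlgebraicClosure k, σ • x = x ^ Nat.card k) {f : ℕ} (hf : 0 < f) :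
    {P : WeierstrassCurve.geomPoints W | σ ^ f • P = P}.Finite := by
  have hq : 1 < Nat.card k := Finite.one_lt_card
  have hσf : ∀ (n : ℕ) (x : AlgebraicClosure k), σ ^ n • x = x ^ (Nat.card k ^ n) := by
    intro n
    induction n with
    | zero => intro x; rw [pow_zero, one_smul, pow_zero, pow_one]
    | succ n ih => intro x; rw [pow_succ, mul_smul, hσ, smul_pow', ih, ← pow_mul, ← pow_succ]
  have hqf : 1 < Nat.card k ^ f := Nat.one_lt_pow hf.ne' hq
  set S : Set (AlgebraicClosure k) := {x | x ^ (Nat.card k ^ f) = x} with hS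
  have hSfin : S.Finite := by
    refine ((X ^ (Nat.card k ^ f) - X : (AlgebraicClosure k)[X]).roots.toFinset.finite_toSet).subset
      fun x hx ↦ ?_
    rw [Finset.mem_coe, Multiset.mem_toFinset, mem_roots (FiniteField.X_pow_card_sub_X_ne_zero _ hqf),
      IsRoot.def, eval_sub, eval_pow, eval_X, sub_eq_zero]
    exact hx
  haveI : Finite S := hSfin.to_subtype
  -- inject the fixed points into `Option (S × S)`
  let g : {P : WeierstrassCurve.geomPoints W | σ ^ f • P = P} → Option (S × S) := fun P ↦
    match hP : (P.1 : (W.baseChange (AlgebraicClosure k)).toAffine.Point) with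
    | .zero => none
    | .some x y h => some (⟨x, by
        have h1 : σ ^ f • (P.1 : (W.baseChange (AlgebraicClosure k)).toAffine.Point) = P.1 := P.2
        rw [hP] at h1
        change WeierstrassCurve.Affine.Point.map
          ((show AlgebraicClosure k ≃ₐ[k] AlgebraicClosure k from σ ^ f) :
            AlgebraicClosure k →ₐ[k] AlgebraicClosure k) (.some x y h) = _ at h1
        rw [WeierstrassCurve.Affine.Point.map_some] at h1
        simp only [WeierstrassCurve.Affine.Point.some.injEq] at h1
        have h2 : (σ ^ f) • x = x := h1.1
        rw [hσf f] at h2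
        exact h2⟩, ⟨y, by
        have h1 : σ ^ f • (P.1 : (W.baseChange (AlgebraicClosure k)).toAffine.Point) = P.1 := P.2
        rw [hP] at h1
        change WeierstrassCurve.Affine.Point.map
          ((show AlgebraicClosure k ≃ₐ[k] AlgebraicClosure k from σ ^ f) :
            AlgebraicClosure k →ₐ[k] AlgebraicClosure k) (.some x y h) = _ at h1
        rw [WeierstrassCurve.Affine.Point.map_some] at h1
        simp only [WeierstrassCurve.Affine.Point.some.injEq] at h1
        have h2 : (σ ^ f) • y = y := h1.2
        rw [hσf f] at h2
        exact h2⟩)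
  have hg : Function.Injective g := by
    rintro ⟨P, hP⟩ ⟨Q, hQ⟩ hPQ
    apply Subtype.ext
    change (W.baseChange (AlgebraicClosure k)).toAffine.Point at P Q
    rcases P with _ | ⟨x, y, h⟩ <;> rcases Q with _ | ⟨x', y', h'⟩
    · rfl
    · exact absurd hPQ (by simp [g])
    · exact absurd hPQ (by simp [g])
    · simp only [g, Option.some.injEq, Prod.mk.injEq, Subtype.mk.injEq] at hPQ
      obtain ⟨rfl, rfl⟩ := hPQ
      rfl
  exact Set.finite_coe_iff.mp (Finite.of_injective g hg)

/-! ### Endomorphisms of a divisible `p`-primary torsion group with finite kernel are onto -/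

/-- **Counting lemma.** Let `A` be an abelian group in which every element is `p`-divisible and
every `A[p^k]` is finite, and `M : A →+ A`. If the elements of the `p`-primary torsion
`A[p^∞]` killed by `M` form a finite set, then `M` maps `A[p^∞]` onto `A[p^∞]`: for `a ∈ A[p^k]`
and `p^s ≥ #ker`, the image of `B = A[p^{k+s}]` under `M` has index `#ker(M|_B) ∣ p^s` in `B`,
hence contains `p^s B ∋ a`. [folklore] -/
theorem exists_eq_of_finite_ker {A : Type*} [AddCommGroup A] {p : ℕ} [hp : Fact p.Prime]
    (hdiv : ∀ a : A, ∃ b : A, p • b = a)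
    (hfin : ∀ k : ℕ, (AddSubgroup.torsionBy A (p ^ k : ℕ) : Set A).Finite)
    (hcard : ∀ k : ℕ, ∃ e : ℕ, Nat.card (AddSubgroup.torsionBy A (p ^ k : ℕ)) = p ^ e)
    (M : A →+ A)
    (hker : {a : A | a ∈ AddCommGroup.primaryComponent A p ∧ M a = 0}.Finite)
    {a : A} (ha : a ∈ AddCommGroup.primaryComponent A p) :
    ∃ z ∈ AddCommGroup.primaryComponent A p, M z = a := by
  obtain ⟨k, hk⟩ := (AddCommGroup.mem_primaryComponent).mp ha
  haveI : Finite {a : A | a ∈ AddCommGroup.primaryComponent A p ∧ M a = 0} := hker.to_subtype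
  -- `c` with `#ker ≤ c ≤ p ^ c`
  set c := Nat.card {a : A | a ∈ AddCommGroup.primaryComponent A p ∧ M a = 0} with hc
  have hcs : c ≤ p ^ c := (Nat.lt_pow_self hp.out.one_lt).le
  -- iterated divisibility
  have hdivn : ∀ (n : ℕ) (x : A), ∃ b : A, p ^ n • b = x := by
    intro n
    induction n with
    | zero => exact fun x ↦ ⟨x, by rw [pow_zero, one_nsmul]⟩
    | succ n ih =>
      intro x
      obtain ⟨b₂, hb₂⟩ := hdiv x
      obtain ⟨b, hb⟩ := ih b₂
      exact ⟨b, by rw [pow_succ', mul_nsmul', hb, hb₂]⟩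
  -- the finite layer `B = A[p^(k+c)]` and the restriction of `M`
  set B : AddSubgroup A := AddSubgroup.torsionBy A (p ^ (k + c) : ℕ) with hB
  have hmemB : ∀ x : A, x ∈ B ↔ (p ^ (k + c)) • x = 0 := fun x ↦ by
    rw [hB]
    change ((p ^ (k + c) : ℕ) : ℤ) • x = 0 ↔ _
    rw [natCast_zsmul]
  haveI : Finite B := (hfin (k + c)).to_subtype
  have hMB : ∀ x ∈ B, M x ∈ B := fun x hx ↦ by
    rw [hmemB] at hx ⊢
    rw [← map_nsmul, hx, map_zero]
  set MB : B →+ B := (M.comp B.subtype).codRestrict B (fun x ↦ hMB x x.2) with hMBdef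
  have hMBapply : ∀ x : B, (MB x : A) = M x := fun _ ↦ rfl
  -- `#ker MB ≤ c`, and it is a power of `p`
  have hker_le : Nat.card MB.ker ≤ c := by
    refine Nat.card_le_card_of_injective
      (fun x : MB.ker ↦ (⟨((x : B) : A), ⟨(AddCommGroup.mem_primaryComponent).mpr ⟨k + c, ?_⟩, ?_⟩⟩ :
        {a : A | a ∈ AddCommGroup.primaryComponent A p ∧ M a = 0})) ?_
    · exact (hmemB _).mp (x : B).2
    · have hx : MB x = 0 := x.2
      rw [← hMBapply, hx, AddSubgroup.coe_zero]
    · intro x y hxy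
      simp only [Subtype.mk.injEq] at hxy
      exact Subtype.ext (Subtype.ext hxy)
  obtain ⟨e, he⟩ := hcard (k + c)
  have hdvdB : Nat.card MB.ker ∣ p ^ e := by
    rw [← he]
    exact AddSubgroup.card_addSubgroup_dvd_card MB.ker
  obtain ⟨i, -, hi⟩ := (Nat.dvd_prime_pow hp.out).mp hdvdB
  have hic : i ≤ c := by
    have h1 : p ^ i ≤ p ^ c := by rw [← hi]; exact hker_le.trans hcs
    exact (Nat.pow_le_pow_iff_right hp.out.one_lt).mp h1
  -- the index of the image is `#ker MB`
  have hindex : MB.range.index = p ^ i := by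
    have h1 := AddSubgroup.card_mul_index MB.ker
    have h2 := AddSubgroup.card_mul_index MB.range
    have h0 : MB.ker.index = Nat.card MB.range := by
      rw [AddSubgroup.index_eq_card]
      exact Nat.card_congr (QuotientAddGroup.quotientKerEquivRange MB).toEquiv
    rw [h0] at h1
    rw [← hi]
    have hpos : 0 < Nat.card MB.range := Nat.card_pos
    apply Nat.eq_of_mul_eq_mul_left hpos
    rw [h2, ← h1, mul_comm]
  -- `p ^ c • B ⊆ range MB`
  have hrange : ∀ x : B, p ^ c • x ∈ MB.range := by
    intro x
    have h1 : p ^ i • x ∈ MB.range := by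
      rw [← hindex]
      exact MB.range.nsmul_index_mem x
    have e : p ^ c = p ^ (c - i) * p ^ i := by rw [← pow_add, Nat.sub_add_cancel hic]
    rw [e, mul_nsmul']
    exact MB.range.nsmul_mem h1 _
  -- write `a = p ^ c • a'` with `a' ∈ B`
  obtain ⟨a', ha'⟩ := hdivn c a
  have ha'B : a' ∈ B := by
    rw [hmemB, pow_add, mul_nsmul', ha', hk]
  obtain ⟨z, hz⟩ := hrange ⟨a', ha'B⟩
  refine ⟨(z : A), (AddCommGroup.mem_primaryComponent).mpr ⟨k + c, (hmemB _).mp z.2⟩, ?_⟩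
  rw [← hMBapply, hz, AddSubgroup.coe_nsmul]
  exact ha'

/-! ### Surjectivity of `φ^f - 1` on `E[p^∞]` at a good place `v ∤ p` -/

variable {K : Type u} [Field K] [NumberField K] (W : WeierstrassCurve K) [W.IsElliptic]

/-- **`φ^f - 1` is onto `E[p^∞]`.** Let `E/K` be an elliptic curve over a number field, `v ∤ p` a
place of good reduction, `𝔐` a prime of `\bar 𝓞_v`, `ι : K̄ → K̄_v`, `σ ∈ Γ_{K_v}` an arithmetic
Frobenius at `𝔐` and `φ = σ|_{K̄} ∈ Γ_K`. For every `f ≥ 1` and `a ∈ E[p^∞]` there is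
`z ∈ E[p^∞]` with `φ^f z - z = a`: the kernel of `φ^f - 1` on `E[p^∞]` injects, by the
Frobenius-equivariant reduction map on `p`-primary torsion
(`WeierstrassCurve.exists_reduceTorsionHom`), into the finitely many points of `Ẽ_v` fixed by
`σ_q^f` (`finite_setOf_frobenius_pow_smul_eq`), and `exists_eq_of_finite_ker` applies (`E(K̄)`
is divisible, `E[p^k]` is finite). [folklore] -/
theorem exists_mem_geomPrimaryTorsion_frobenius_pow_sub_eq {p : ℕ} [Fact p.Prime]
    {v : HeightOneSpectrum (𝓞 K)} (hp : (p : 𝓞 K) ∉ v.asIdeal) (hv : W.HasGoodReductionAt v)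
    {𝔐 : Ideal (localAbsIntegers v)} (h𝔐 : 𝔐 ∈ v.localPrimesAbove)
    (ι : AlgebraicClosure K →ₐ[K] AlgebraicClosure (v.adicCompletion K))
    {σ : absoluteGaloisGroup (v.adicCompletion K)}
    (hσ : IsArithFrobAt (v.adicCompletionIntegers K) σ 𝔐) {f : ℕ} (hf : 0 < f)
    {a : WeierstrassCurve.geomPoints W} (ha : a ∈ WeierstrassCurve.geomPrimaryTorsion W p) :
    ∃ z ∈ WeierstrassCurve.geomPrimaryTorsion W p, (resGalOfEmb ι σ) ^ f • z - z = a := by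
  obtain ⟨φk, hφk⟩ := WeierstrassCurve.exists_frobenius_absoluteGaloisGroup
    (IsLocalRing.ResidueField (v.adicCompletionIntegers K))
  obtain ⟨red, hred, hredσ⟩ := WeierstrassCurve.exists_reduceTorsionHom hp hv h𝔐 ι hσ hφk
  set φ : absoluteGaloisGroup K := resGalOfEmb ι σ with hφdef
  -- the endomorphism `φ^f - 1`
  set M : WeierstrassCurve.geomPoints W →+ WeierstrassCurve.geomPoints W :=
    DistribSMul.toAddMonoidHom _ (φ ^ f) - AddMonoidHom.id _ with hM
  have hMapply : ∀ x, M x = φ ^ f • x - x := fun _ ↦ rfl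
  -- equivariance of the reduction for powers of `φ`
  have hredn : ∀ (n : ℕ) (P : WeierstrassCurve.geomPrimaryTorsion W p),
      red (φ ^ n • P) = φk ^ n • red P := by
    intro n P
    induction n with
    | zero => rw [pow_zero, pow_zero, one_smul, one_smul]
    | succ n ih => rw [pow_succ', mul_smul, hredσ, ih, pow_succ', mul_smul]
  -- finiteness of the kernel on `E[p^∞]`
  have hker : {x : WeierstrassCurve.geomPoints W |
      x ∈ WeierstrassCurve.geomPrimaryTorsion W p ∧ M x = 0}.Finite := by
    have hfix := finite_setOf_frobenius_pow_smul_eq (W.reductionAt v) hφk hf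
    haveI := hfix.to_subtype
    refine Set.finite_coe_iff.mp (Finite.of_injective
      (fun x : {x : WeierstrassCurve.geomPoints W |
          x ∈ WeierstrassCurve.geomPrimaryTorsion W p ∧ M x = 0} ↦
        (⟨red ⟨x.1, x.2.1⟩, ?_⟩ : {P : WeierstrassCurve.geomPoints (W.reductionAt v) | φk ^ f • P = P}))
      ?_)
    · have hx : φ ^ f • (x : WeierstrassCurve.geomPoints W) = x := by
        have := x.2.2
        rw [hMapply, sub_eq_zero] at this
        exact this
      change φk ^ f • red ⟨x.1, x.2.1⟩ = red ⟨x.1, x.2.1⟩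
      rw [← hredn]
      congr 1
      exact Subtype.ext hx
    · intro x y hxy
      simp only [Subtype.mk.injEq] at hxy
      have h2 := congrArg (fun P : WeierstrassCurve.geomPrimaryTorsion W p ↦
        (P : WeierstrassCurve.geomPoints W)) (hred hxy)
      exact Subtype.ext h2
  -- divisibility and finiteness of the layers
  have hdiv : ∀ x : WeierstrassCurve.geomPoints W, ∃ b, p • b = x := fun x ↦ by
    obtain ⟨b, hb⟩ := WeierstrassCurve.zsmul_geomPoints_surjective_holds W (n := (p : ℤ))
      (by exact_mod_cast (Fact.out : p.Prime).ne_zero) x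
    exact ⟨b, by rw [← natCast_zsmul]; exact hb⟩
  have hfin : ∀ j : ℕ, (AddSubgroup.torsionBy (WeierstrassCurve.geomPoints W) (p ^ j : ℕ) :
      Set (WeierstrassCurve.geomPoints W)).Finite := fun j ↦ by
    haveI : Finite (WeierstrassCurve.geomTorsion W (p ^ j : ℕ)) :=
      WeierstrassCurve.finite_torsionPoints_holds W (AlgebraicClosure K)
        (by exact_mod_cast pow_ne_zero j (Fact.out : p.Prime).ne_zero)
    exact Set.toFinite _
  have hcard : ∀ j : ℕ, ∃ e : ℕ,
      Nat.card (AddSubgroup.torsionBy (WeierstrassCurve.geomPoints W) (p ^ j : ℕ)) = p ^ e :=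
    fun j ↦ ⟨2 * j, by
      rw [pow_mul']
      exact WeierstrassCurve.card_torsionPoints_eq_sq_holds W (AlgebraicClosure K)
        (by exact_mod_cast pow_ne_zero j (Fact.out : p.Prime).ne_zero)⟩
  obtain ⟨z, hz, hMz⟩ := exists_eq_of_finite_ker hdiv hfin hcard M hker ha
  exact ⟨z, hz, hMz⟩

/-- **The nice-point supply at a good place** (hypothesis `hnice` of
`sq_dvd_card_of_twistInvariant_decompositionSubgroup`, for `P` a power of `p`, `v ∤ p`): for
`f ≥ 1` and `a ∈ E(K̄)` with `P a = O` there is `z ∈ E(K̄)` fixed by the inertia group of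
`𝔓 = 𝔓_{ι,𝔐}` with `φ^f z - z = a`, `φ = σ|_{K̄}` the restriction of a local arithmetic Frobenius;
`z` is taken in `E[p^∞]`, on which inertia acts trivially (Silverman VII.4.1,
`WeierstrassCurve.smul_eq_of_mem_inertia_of_nsmul_eq_zero`). [cite: SilvermanAEC2009, Prop. VII.4.1] -/
theorem exists_inertia_fixed_frobenius_pow_sub_eq {p : ℕ} [Fact p.Prime] {n : ℕ}
    {v : HeightOneSpectrum (𝓞 K)} (hp : (p : 𝓞 K) ∉ v.asIdeal) (hv : W.HasGoodReductionAt v)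
    {𝔐 : Ideal (localAbsIntegers v)} (h𝔐 : 𝔐 ∈ v.localPrimesAbove)
    (ι : AlgebraicClosure K →ₐ[K] AlgebraicClosure (v.adicCompletion K))
    {σ : absoluteGaloisGroup (v.adicCompletion K)}
    (hσ : IsArithFrobAt (v.adicCompletionIntegers K) σ 𝔐) {f : ℕ} (hf : 0 < f)
    (a : WeierstrassCurve.geomPoints W) (ha : p ^ n • a = 0) :
    ∃ z : WeierstrassCurve.geomPoints W,
      (∀ τ ∈ (v.primeBelow ι 𝔐).inertia (absoluteGaloisGroup K), τ • z = z) ∧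
        (resGalOfEmb ι σ) ^ f • z - z = a := by
  obtain ⟨z, hz, hzeq⟩ := exists_mem_geomPrimaryTorsion_frobenius_pow_sub_eq W hp hv h𝔐 ι hσ hf
    ((AddCommGroup.mem_primaryComponent).mpr ⟨n, ha⟩)
  obtain ⟨j, hj⟩ := (AddCommGroup.mem_primaryComponent).mp hz
  refine ⟨z, fun τ hτ ↦ ?_, hzeq⟩
  exact W.smul_eq_of_mem_inertia_of_zsmul_eq_zero hv (n := ((p ^ j : ℕ) : ℤ))
    (WeierstrassCurve.pow_natCast_not_mem hp j)
    (primeBelow_mem_primesAbove (ι := ι) h𝔐) hτ (by rw [natCast_zsmul]; exact hj)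

end Literature.NumberTheory.EllipticCurves
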